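import Mathlib

/-!
# The partial conjugate gradient method: the eigenvalue-cluster rate (Luenberger–Ye 2008, §8.5)

Literature anchor for D. G. Luenberger, Y. Ye, *Linear and Nonlinear Programming*, 3rd ed.,
Springer 2008 [LuenbergerYe2008], Chapter 8 "Conjugate Direction Methods", §8.5 "The partial
conjugate gradient method" (held copy `book:luenberger2008-linear-nonlinear-programming`, §8.5
pp. 245–248 read; same numbering in the Springer printing).

The method restarts the conjugate gradient iteration every `m + 1` steps, so that
`x_{k+1} = x_k + Pᵏ(Q)g_k` with `Pᵏ` the polynomial of degree `m` minimising
`E(x_{k+1}) = ½(x_{k+1} − x*)ᵀQ(x_{k+1} − x*)` ((28)–(30)).  By Theorem 2 of §8.4 ((27), in the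
tree as `Literature.Analysis.Convex.ConjugateGradientOptimality`),
`E(x_{k+1}) ≤ max_i [1 + λ_i P(λ_i)]² E(x_k)` for *every* polynomial `P` of degree `m` ((32)),
the `λ_i` being the eigenvalues of `Q`.

**Theorem (Partial conjugate gradient method).** If the symmetric positive definite `Q` has
`n − m` eigenvalues in `[a, b]`, `a > 0`, and the remaining `m` eigenvalues are greater than `b`,
then the method restarted every `m + 1` steps satisfies
`E(x_{k+1}) ≤ ((b − a)/(b + a))² E(x_k)` ((31)).

The proof is a polynomial certificate: choose `P` so that `q(λ) = 1 + λP(λ)` (degree `m + 1`)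
vanishes at `(a + b)/2` and at the `m` large eigenvalues (Fig. 8.4), and show
`|q(λ)| ≤ |1 − 2λ/(a + b)|` on `[a, b]`.  The book argues through the interlacing of the roots of
`q`, `q'`, `q''` and convexity of `q` left of `(a + b)/2`; this file records the same certificate
in closed form, `q(λ) = (1 − 2λ/(a + b)) ∏ᵢ (1 − λ/Λᵢ)`, for which the inequality is immediate on
the whole of `[0, b]` because every factor `1 − λ/Λᵢ` lies in `[0, 1]` there (a shorter route to
the book's inequality, not the book's argument).  Contents:

* `clusterPoly a b Λ` — the certificate `q`; `clusterPoly_eval`, `clusterPoly_eval_zero`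
  (`q(0) = 1`), `clusterPoly_eval_large` (`q(Λᵢ) = 0`), `clusterPoly_eval_midpoint`
  (`q((a+b)/2) = 0`), `natDegree_clusterPoly_le` (`deg q ≤ m + 1`),
  `exists_eq_one_add_X_mul` (`q = 1 + X·P` with `deg P ≤ m`, the `P` of (29)/(32));
* `abs_clusterPoly_eval_le` (`|q(λ)| ≤ |1 − 2λ/(a+b)|` on `[0, b]`), `abs_midpointLine_le`
  (`|1 − 2λ/(a+b)| ≤ (b − a)/(b + a)` on `[a, b]`), `sq_eval_le_on_spectrum` (the bound
  `q(λ)² ≤ ((b − a)/(b + a))²` at every eigenvalue, small or large);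
* `exists_polynomial_rate` — the certificate in the shape consumed by (32): a `P` with
  `P.natDegree ≤ m` and `(1 + λ * P.eval λ)² ≤ ((b − a)/(b + a))²` on the spectrum — literally the
  arguments `P`, `hP`, `hρ` (with `k = m`, `ρ = ((b − a)/(b + a))²`) of the in-tree Theorem 2
  `Literature.Analysis.Convex.ConjugateGradientOptimality.conjugateGradient_eigenvalue_bound`
  (not imported here; that file lists §8.5 (31) as "not formalised");
  `rate_of_optimality_bound` — (31) from (32)/(27) taken as a hypothesis;
  `steepestDescent_rate_of_optimality_bound` — the remark after the proof: for `m = 0` this is a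
  derivation of the steepest-descent rate `((A − a)/(A + a))²` (the Kantorovich route is the
  in-tree `Literature.Analysis.Convex.SteepestDescentQuadraticRate.steepestDescent_rate`).
-/

namespace Literature.Analysis.Convex.PartialConjugateGradient

open Polynomial Finset

variable {m : ℕ}

/-- The certificate polynomial of the proof of the Partial Conjugate Gradient Theorem:
`q(λ) = (1 − 2λ/(a + b)) ∏ᵢ (1 − λ/Λᵢ)`, vanishing at `(a + b)/2` and at the `m` large
eigenvalues `Λ₀, …, Λ_{m−1}`, with `q(0) = 1`.
[cite: LuenbergerYe2008, §8.5 Theorem (Partial conjugate gradient method), proof and Fig. 8.4] -/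
noncomputable def clusterPoly (a b : ℝ) (Λ : Fin m → ℝ) : ℝ[X] :=
  (C 1 - C (2 / (a + b)) * X) * ∏ i, (C 1 - C (1 / Λ i) * X)

/-- Closed-form evaluation of the certificate.
[cite: LuenbergerYe2008, §8.5 Theorem (Partial conjugate gradient method), proof] -/
theorem clusterPoly_eval (a b : ℝ) (Λ : Fin m → ℝ) (t : ℝ) :
    (clusterPoly a b Λ).eval t = (1 - 2 / (a + b) * t) * ∏ i, (1 - 1 / Λ i * t) := by
  simp [clusterPoly, eval_prod]

/-- `q(0) = 1`, i.e. `q` has the form `1 + λP(λ)`.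
[cite: LuenbergerYe2008, §8.5 proof ("the (m+1)th-degree polynomial q(λ) = 1 + λP(λ)")] -/
theorem clusterPoly_eval_zero (a b : ℝ) (Λ : Fin m → ℝ) : (clusterPoly a b Λ).eval 0 = 1 := by
  simp [clusterPoly_eval]

/-- `q` vanishes at each of the `m` large eigenvalues.
[cite: LuenbergerYe2008, §8.5 proof ("vanishes … at the m large eigenvalues of Q"), Fig. 8.4] -/
theorem clusterPoly_eval_large (a b : ℝ) {Λ : Fin m → ℝ} (i : Fin m) (hΛ : Λ i ≠ 0) :
    (clusterPoly a b Λ).eval (Λ i) = 0 := by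
  rw [clusterPoly_eval]
  refine mul_eq_zero_of_right _ (Finset.prod_eq_zero (Finset.mem_univ i) ?_)
  rw [one_div, inv_mul_cancel₀ hΛ, sub_self]

/-- `q` vanishes at the midpoint `(a + b)/2` of the small-eigenvalue interval.
[cite: LuenbergerYe2008, §8.5 proof ("q(λ) = 1 + λP(λ) vanishes at (a+b)/2"), Fig. 8.4] -/
theorem clusterPoly_eval_midpoint {a b : ℝ} (hab : a + b ≠ 0) (Λ : Fin m → ℝ) :
    (clusterPoly a b Λ).eval ((a + b) / 2) = 0 := by
  rw [clusterPoly_eval]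
  refine mul_eq_zero_of_left ?_ _
  field_simp
  ring

/-- A linear factor `1 − cλ` has degree at most one. [folklore] -/
private theorem natDegree_linFactor_le (c : ℝ) : (C 1 - C c * X : ℝ[X]).natDegree ≤ 1 := by
  refine (natDegree_sub_le _ _).trans ?_
  rw [natDegree_C, Nat.zero_max]
  exact (natDegree_C_mul_le c X).trans natDegree_X_le

/-- `q` has degree at most `m + 1`.
[cite: LuenbergerYe2008, §8.5 proof ("the (m+1)th-degree polynomial q")] -/
theorem natDegree_clusterPoly_le (a b : ℝ) (Λ : Fin m → ℝ) :
    (clusterPoly a b Λ).natDegree ≤ m + 1 := by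
  unfold clusterPoly
  refine (natDegree_mul_le).trans ?_
  have h1 := natDegree_linFactor_le (2 / (a + b))
  have h2 : (∏ i : Fin m, (C 1 - C (1 / Λ i) * X : ℝ[X])).natDegree ≤ m := by
    refine (natDegree_prod_le _ _).trans ?_
    calc ∑ i : Fin m, (C 1 - C (1 / Λ i) * X : ℝ[X]).natDegree ≤ ∑ _i : Fin m, 1 :=
          Finset.sum_le_sum fun i _ => natDegree_linFactor_le _
      _ = m := by simp
  omega

/-- `q = 1 + X·P` for a polynomial `P` of degree at most `m` — the polynomial `P = Pᵏ` of the
iteration (29) whose existence the proof needs in (32).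
[cite: LuenbergerYe2008, §8.5 (29), (32) and proof ("Let us select P so that …")] -/
theorem exists_eq_one_add_X_mul (a b : ℝ) (Λ : Fin m → ℝ) :
    ∃ P : ℝ[X], P.natDegree ≤ m ∧ clusterPoly a b Λ = 1 + X * P := by
  have hdvd : (X : ℝ[X]) ∣ clusterPoly a b Λ - 1 := by
    rw [X_dvd_iff, coeff_sub, coeff_one_zero, coeff_zero_eq_eval_zero, clusterPoly_eval_zero,
      sub_self]
  obtain ⟨P, hP⟩ := hdvd
  refine ⟨P, ?_, by rw [← hP]; ring⟩
  by_cases hP0 : P = 0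
  · simp [hP0]
  have hdeg : (X * P).natDegree ≤ m + 1 := by
    rw [← hP]
    refine (natDegree_sub_le _ _).trans ?_
    rw [natDegree_one, Nat.max_zero]
    exact natDegree_clusterPoly_le a b Λ
  rw [natDegree_X_mul hP0] at hdeg
  omega

/-- The key inequality of the proof, `|1 + λP(λ)| ≤ |1 − 2λ/(a + b)|`, here on all of `[0, b]`
(the book needs it on `[a, b]`): each factor `1 − λ/Λᵢ` lies in `[0, 1]` because `Λᵢ > b ≥ λ`.
[cite: LuenbergerYe2008, §8.5 proof ("the inequality |1 + λP(λ)| ≤ |1 − 2λ/(a+b)| is valid on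
the interval [a, b]")] -/
theorem abs_clusterPoly_eval_le {a b : ℝ} {Λ : Fin m → ℝ} (hb : 0 ≤ b) (hΛ : ∀ i, b < Λ i)
    {t : ℝ} (ht0 : 0 ≤ t) (htb : t ≤ b) :
    |(clusterPoly a b Λ).eval t| ≤ |1 - 2 / (a + b) * t| := by
  rw [clusterPoly_eval, abs_mul, Finset.abs_prod]
  refine mul_le_of_le_one_right (abs_nonneg _) (Finset.prod_le_one (fun i _ => abs_nonneg _) ?_)
  intro i _
  have hΛpos : 0 < Λ i := hb.trans_lt (hΛ i)
  have hle : 1 / Λ i * t ≤ 1 := by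
    rw [one_div, inv_mul_le_iff₀ hΛpos, mul_one]
    exact htb.trans (hΛ i).le
  have hnn : 0 ≤ 1 / Λ i * t := mul_nonneg (by positivity) ht0
  rw [abs_of_nonneg (by linarith)]
  linarith

/-- On `[a, b]` the line `1 − 2λ/(a + b)` is bounded in absolute value by `(b − a)/(b + a)`.
[cite: LuenbergerYe2008, §8.5 proof ("The final result (31) follows immediately")] -/
theorem abs_midpointLine_le {a b : ℝ} (ha : 0 < a) (hab : a ≤ b) {t : ℝ} (hta : a ≤ t) (htb : t ≤ b) :
    |1 - 2 / (a + b) * t| ≤ (b - a) / (b + a) := by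
  have hpos : 0 < a + b := by linarith
  have h : 1 - 2 / (a + b) * t = (a + b - 2 * t) / (a + b) := by
    field_simp
  rw [h, abs_div, abs_of_pos hpos, add_comm b a]
  exact div_le_div_of_nonneg_right (abs_le.2 ⟨by linarith, by linarith⟩) hpos.le

/-- The certificate's value squared is at most `((b − a)/(b + a))²` at every eigenvalue of `Q`:
at a small eigenvalue `λ ∈ [a, b]` by the two previous lemmas, at a large one because `q(Λᵢ) = 0`.
[cite: LuenbergerYe2008, §8.5 proof ((32) restricted to a ≤ λ_i ≤ b)] -/
theorem sq_eval_le_on_spectrum {a b : ℝ} (ha : 0 < a) (hab : a ≤ b) {Λ : Fin m → ℝ}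
    (hΛ : ∀ i, b < Λ i) {t : ℝ} (ht : (a ≤ t ∧ t ≤ b) ∨ ∃ i, t = Λ i) :
    ((clusterPoly a b Λ).eval t) ^ 2 ≤ ((b - a) / (b + a)) ^ 2 := by
  rcases ht with ⟨hta, htb⟩ | ⟨i, rfl⟩
  · have h1 := abs_clusterPoly_eval_le (a := a) (ha.le.trans hab) hΛ (ha.le.trans hta) htb
    have h2 := abs_midpointLine_le ha hab hta htb
    have hq : |(clusterPoly a b Λ).eval t| ≤ (b - a) / (b + a) := h1.trans h2
    have hnn : 0 ≤ (b - a) / (b + a) := div_nonneg (by linarith) (by linarith)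
    calc ((clusterPoly a b Λ).eval t) ^ 2 = |(clusterPoly a b Λ).eval t| ^ 2 := (sq_abs _).symm
      _ ≤ ((b - a) / (b + a)) ^ 2 := pow_le_pow_left₀ (abs_nonneg _) hq 2
  · have hΛ0 : Λ i ≠ 0 := (lt_of_le_of_lt (ha.le.trans hab) (hΛ i)).ne'
    rw [clusterPoly_eval_large a b i hΛ0, zero_pow two_ne_zero]
    positivity

/-- **The polynomial certificate behind (31).** If `a > 0`, `a ≤ b` and the large eigenvalues
exceed `b`, there is a polynomial `P` of degree at most `m` with
`[1 + λP(λ)]² ≤ ((b − a)/(b + a))²` at every eigenvalue `λ` (in `[a, b]` or equal to some `Λᵢ`).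
[cite: LuenbergerYe2008, §8.5 Theorem (Partial conjugate gradient method), proof] -/
theorem exists_polynomial_rate {a b : ℝ} (ha : 0 < a) (hab : a ≤ b) (Λ : Fin m → ℝ)
    (hΛ : ∀ i, b < Λ i) :
    ∃ P : ℝ[X], P.natDegree ≤ m ∧
      ∀ t : ℝ, ((a ≤ t ∧ t ≤ b) ∨ ∃ i, t = Λ i) →
        (1 + t * P.eval t) ^ 2 ≤ ((b - a) / (b + a)) ^ 2 := by
  obtain ⟨P, hPdeg, hq⟩ := exists_eq_one_add_X_mul a b Λ
  refine ⟨P, hPdeg, fun t ht => ?_⟩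
  have heval : 1 + t * P.eval t = (clusterPoly a b Λ).eval t := by
    rw [hq, eval_add, eval_one, eval_mul, eval_X]
  rw [heval]
  exact sq_eval_le_on_spectrum ha hab hΛ ht

/-- **Theorem (Partial conjugate gradient method), (31) from (32).** Suppose the error after a
restart cycle obeys the optimality bound (32)/(27) of §8.4 — `E' ≤ max_i [1 + λ_i P(λ_i)]² · E`
for every polynomial `P` of degree at most `m` — where the eigenvalues `λ_i` of `Q` lie in
`[a, b]`, `a > 0`, except for `m` of them, `Λ₀, …, Λ_{m−1} > b`.  Then
`E' ≤ ((b − a)/(b + a))² E`.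
[cite: LuenbergerYe2008, §8.5 Theorem (Partial conjugate gradient method), (31)–(32)] -/
theorem rate_of_optimality_bound {ι : Type*} [Fintype ι] [Nonempty ι] {a b : ℝ} (ha : 0 < a)
    (hab : a ≤ b) (Λ : Fin m → ℝ) (hΛ : ∀ i, b < Λ i) (eig : ι → ℝ)
    (heig : ∀ i, (a ≤ eig i ∧ eig i ≤ b) ∨ ∃ j, eig i = Λ j) {E E' : ℝ} (hE : 0 ≤ E)
    (h32 : ∀ P : ℝ[X], P.natDegree ≤ m →
      E' ≤ (Finset.univ.sup' Finset.univ_nonempty fun i => (1 + eig i * P.eval (eig i)) ^ 2) * E) :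
    E' ≤ ((b - a) / (b + a)) ^ 2 * E := by
  obtain ⟨P, hPdeg, hP⟩ := exists_polynomial_rate ha hab Λ hΛ
  refine (h32 P hPdeg).trans (mul_le_mul_of_nonneg_right ?_ hE)
  exact Finset.sup'_le _ _ fun i _ => hP (eig i) (heig i)

/-- The remark closing the proof: for `m = 0` (no large eigenvalues, restart every step, i.e.
steepest descent) the same certificate gives the steepest-descent rate
`E(x_{k+1}) ≤ ((A − a)/(A + a))² E(x_k)` for eigenvalues in `[a, A]` — "a simple derivation of the
Steepest Descent Theorem". [cite: LuenbergerYe2008, §8.5, remark after the proof (m = 0)] -/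
theorem steepestDescent_rate_of_optimality_bound {ι : Type*} [Fintype ι] [Nonempty ι] {a A : ℝ} (ha : 0 < a)
    (haA : a ≤ A) (eig : ι → ℝ) (heig : ∀ i, a ≤ eig i ∧ eig i ≤ A) {E E' : ℝ} (hE : 0 ≤ E)
    (h32 : ∀ P : ℝ[X], P.natDegree ≤ 0 →
      E' ≤ (Finset.univ.sup' Finset.univ_nonempty fun i => (1 + eig i * P.eval (eig i)) ^ 2) * E) :
    E' ≤ ((A - a) / (A + a)) ^ 2 * E :=
  rate_of_optimality_bound (m := 0) ha haA Fin.elim0 (fun i => i.elim0) eig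
    (fun i => Or.inl (heig i)) hE h32

end Literature.Analysis.Convex.PartialConjugateGradient
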